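import Literature.Probability.LatticeModels.BalabanStepOneFormatXYCalibration
import Literature.Probability.LatticeModels.BalabanStepOneFormatBasic
import Summits.HubbardSuperconductivity.HubbardSuperconductivity.Theorems.BalabanIRBirSliceXYOrderRP
import HarnessLib

/-!
# `BirFormatEngine` on its calibration member: the XY Gibbs weight satisfies the engine conclusion

Support for crux 4R `BalabanIR.BirGappedPhaseReductionR` (stmt-HubbardSuperconductivity-14846), line
`format-pair`, stub C1 `BirFormatEngine` (the format engine over
`Literature.Probability.LatticeModels.BalabanStepOne.StepOneFormat`): the nearest-neighbour XY Gibbs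
weight `xyWeight K = exp (-K·misalign)` of the block torus — the calibration member of the format
(`xyWeight_coerciveWeight`; full membership `xyWeight_stepOneFormat`) — satisfies the engine's
CONCLUSION `EngineConclusion L' M (xyWeight K)` (`Z ≠ 0` and slice order `≥ 1/2`) for `K ≥ K₀`,
`L₀ ≤ L' ≤ M`, `L', M` even (`engineConclusion_xyWeight`).  This is the proved reflection-positivity
instance `birSliceXYOrderRP_proof` (Fröhlich–Simon–Spencer infrared bound, `K₀ = 128`, `L₀ = 4`)
transported to the format's vocabulary: `exp (-K·misalign θ) = exp (-3K|Λ|) · exp (K·E θ)` with `E` the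
bond-cosine sum of `BirSliceXYOrderRP`, the constant cancels in the ratio, and the complex integrals of
the format are the real ones cast.  So C1 restricted to the calibration member is TRUE: the format
engine is a strict strengthening of a proved theorem, not a statement about an empty or trivial class.
-/

set_option linter.dupNamespace false -- tree layout `Summit.<S>.<S>.Theorems` (D-0017)

noncomputable section

namespace Summit.HubbardSuperconductivity.HubbardSuperconductivity.Theorems

open scoped BigOperators Classical
open MeasureTheory Finset Literature.Probability.LatticeModels
open Literature.Probability.LatticeModels.BalabanStepOne
open Summit.HubbardSuperconductivity.HubbardSuperconductivity.Theses.BalabanIR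

variable {L' M : ℕ} [NeZero L'] [NeZero M]

/-- The XY exponent in the two vocabularies: `-K·misalign θ = -3K|Λ| + K·E θ` with `E` the bond-cosine
sum of `BirSliceXYOrderRP`. [folklore] -/
theorem neg_mul_misalign_eq (K : ℝ) (θ : Site L' M → ℝ) :
    -K * misalign θ = -(3 * K * (Fintype.card (Site L' M) : ℝ)) +
      K * ∑ s : Site L' M, (Real.cos (θ s - θ (s.1 + ![1, 0], s.2)) +
        Real.cos (θ s - θ (s.1 + ![0, 1], s.2)) + Real.cos (θ s - θ (s.1, s.2 + 1))) := by
  rw [misalign_eq_three]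
  have h1 : ∀ s : Site L' M, (s + (![1, 0], 0) : Site L' M) = (s.1 + ![1, 0], s.2) := fun s => by
    ext <;> simp
  have h2 : ∀ s : Site L' M, (s + (![0, 1], 0) : Site L' M) = (s.1 + ![0, 1], s.2) := fun s => by
    ext <;> simp
  have h3 : ∀ s : Site L' M, (s + (0, 1) : Site L' M) = (s.1, s.2 + 1) := fun s => by
    ext <;> simp
  have hcos : ∀ a b : ℝ, Real.cos (a - b) = Real.cos (b - a) := fun a b => by
    rw [← Real.cos_neg, neg_sub]
  simp only [h1, h2, h3]
  have hsum : ∑ s : Site L' M, ((1 - Real.cos (θ (s.1 + ![1, 0], s.2) - θ s)) +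
      (1 - Real.cos (θ (s.1 + ![0, 1], s.2) - θ s)) + (1 - Real.cos (θ (s.1, s.2 + 1) - θ s))) =
      3 * (Fintype.card (Site L' M) : ℝ) - ∑ s : Site L' M, (Real.cos (θ s - θ (s.1 + ![1, 0], s.2)) +
        Real.cos (θ s - θ (s.1 + ![0, 1], s.2)) + Real.cos (θ s - θ (s.1, s.2 + 1))) := by
    rw [eq_sub_iff_add_eq, ← sum_add_distrib]
    rw [show (3 * (Fintype.card (Site L' M) : ℝ)) = ∑ _s : Site L' M, (3 : ℝ) by
      rw [sum_const, card_univ, nsmul_eq_mul, mul_comm]]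
    refine sum_congr rfl fun s _ => ?_
    rw [hcos (θ (s.1 + ![1, 0], s.2)) (θ s), hcos (θ (s.1 + ![0, 1], s.2)) (θ s),
      hcos (θ (s.1, s.2 + 1)) (θ s)]
    ring
  rw [hsum]
  ring

/-- **C1 on the calibration member.** The XY Gibbs weight satisfies the format engine's conclusion
(`Z ≠ 0`, slice order `≥ 1/2`) for `K ≥ K₀`, `L₀ ≤ L' ≤ M`, `L', M` even — the reflection-positivity
instance `birSliceXYOrderRP_proof` in the vocabulary of `BalabanStepOne`. [cite: FrohlichSimonSpencer1976, Thm. 3.1] -/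
theorem engineConclusion_xyWeight :
    ∃ K₀ : ℝ, ∃ L₀ : ℕ, ∀ K : ℝ, K₀ ≤ K → ∀ (L' M : ℕ) [NeZero L'] [NeZero M], L₀ ≤ L' → L' ≤ M → Even L' → Even M → Literature.Probability.LatticeModels.BalabanStepOne.EngineConclusion L' M (Literature.Probability.LatticeModels.BalabanStepOne.xyWeight (L' := L') (M := M) K) := by
  obtain ⟨K₀, L₀, h⟩ := birSliceXYOrderRP_proof
  refine ⟨K₀, L₀, fun K hK L' M _ _ hL hLM hLe hMe => ?_⟩
  have hRP := h K hK L' M hL hLM hLe hMe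
  dsimp only at hRP
  -- abbreviations
  set E : (Site L' M → ℝ) → ℝ := fun θ => ∑ s : Site L' M, (Real.cos (θ s - θ (s.1 + ![1, 0], s.2)) +
    Real.cos (θ s - θ (s.1 + ![0, 1], s.2)) + Real.cos (θ s - θ (s.1, s.2 + 1))) with hE
  set O : (Site L' M → ℝ) → ℝ := fun θ =>
    ‖∑ x : TorusSite 2 L', Complex.exp (Complex.I * (θ (x, 0) : ℂ))‖ ^ 2 / (L' : ℝ) ^ 4 with hO
  set c : ℝ := Real.exp (-(3 * K * (Fintype.card (Site L' M) : ℝ))) with hc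
  have hcpos : 0 < c := Real.exp_pos _
  have hRP' : (1 / 2 : ℝ) ≤ (∫ θ in cube L' M, O θ * Real.exp (K * E θ)) / ∫ θ in cube L' M, Real.exp (K * E θ) :=
    hRP
  -- the weight in the two vocabularies
  have hw : ∀ θ : Site L' M → ℝ, Real.exp (-K * misalign θ) = c * Real.exp (K * E θ) := by
    intro θ
    rw [neg_mul_misalign_eq, Real.exp_add]
  have hZ : (∫ θ in cube L' M, xyWeight (L' := L') (M := M) K θ) =
      ((c * ∫ θ in cube L' M, Real.exp (K * E θ) : ℝ) : ℂ) := by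
    unfold xyWeight
    rw [integral_complex_ofReal, ← integral_const_mul]
    congr 1
    exact integral_congr_ae (Filter.Eventually.of_forall fun θ => hw θ)
  have hN : (∫ θ in cube L' M, (sliceOrder L' M θ : ℂ) * xyWeight (L' := L') (M := M) K θ) =
      ((c * ∫ θ in cube L' M, O θ * Real.exp (K * E θ) : ℝ) : ℂ) := by
    unfold xyWeight
    simp_rw [← Complex.ofReal_mul]
    rw [integral_complex_ofReal, ← integral_const_mul]
    congr 1
    refine integral_congr_ae (Filter.Eventually.of_forall fun θ => ?_)
    simp only [sliceOrder, hO, hw θ]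
    ring
  -- the denominator does not vanish (else the RP ratio would be the junk value 0 < 1/2)
  have hZRP : (∫ θ in cube L' M, Real.exp (K * E θ)) ≠ 0 := by
    intro h0
    rw [h0, div_zero] at hRP'
    linarith
  refine ⟨?_, ?_⟩
  · rw [hZ, Complex.ofReal_ne_zero]
    exact mul_ne_zero hcpos.ne' hZRP
  · rw [hZ, hN, ← Complex.ofReal_div, Complex.ofReal_re, mul_div_mul_left _ _ hcpos.ne']
    exact hRP'

end Summit.HubbardSuperconductivity.HubbardSuperconductivity.Theorems

end
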